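import Mathlib
import Summits.NavierStokesRegularity.NavierStokesRegularity.Theorems.EulerZoomLiouvillePowerGaugeEulerLiouvilleSelfSimilarCountableNodalSet
import HarnessLib.Audit

/-!
# Rung C1 of the crux `EulerZoomLiouville.PowerGaugeEulerLiouville`: tools for countable stagnation points
# PLUS sub-stretching continua (KILL without a limit node, zero-free spheres, infDist dichotomy, compactness)

Route №10 `EulerZoomLiouville` (NavierStokesRegularity), crux E = stmt-NavierStokesRegularity-19832,
tenure rung C1 (exactly self-similar members), registered residue `stub_selfSimilarExtremal`.
Tenth file of the NODAL-FINITENESS chain (lineage ns-typeII-p2, gen 6): the TOOLS; the theorem is in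
`…SelfSimilarSubstretchingContinua`.

The two classical-profile exclusions of the lineage have complementary hypotheses on the stagnation set
`𝒩` of `V = γ(y−c) + U` (`0 < γ < ½`, far field (3.8)):
g5 (`IsSelfSimilarEulerProfile.eq_zero_of_stagnation_stretching_lt_one`): `⟪DU(z)w,w⟫ < |w|²` at EVERY
node (any cardinality); g6 (`eq_zero_of_countable_nodalSet`): `𝒩` COUNTABLE (any stretching).  This file
proves the common generalisation: **if `𝒩 ⊆ N₀ ∪ N₁` with `N₀` countable and `N₁` a closed set of
nodes at which the strain is sub-stretching (`⟪DU(z)w,w⟫ < |w|²` for `w ≠ 0`), then `U ≡ 0`** —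
continua of stagnation points (curves, rings, surfaces) are allowed provided the stretching rate stays
below `1` on them; the remaining nodes may be arbitrary but countably many.

* `curl_comp_eq_zero_of_eventually_stretching_le` — KILL along a backward trajectory that eventually
  stays where `⟪DU w,w⟫ ≤ θ₁|w|²`, `θ₁ < 1` (no convergence to a node needed; certificate = the inner
  product; abstract lemma `Literature.Analysis.ODE.eq_zero_of_norm_le_exp_of_lower_certificate`).
* `tendsto_of_transport_comp_tendsto_zero_of_sphereFree` — a bounded curve with `V(Y) → 0` converges to
  its cluster point `z` as soon as arbitrarily small spheres about `z` carry no zero of `V`.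
* `tendsto_or_infDist_tendsto_zero` — dichotomy for a backward trajectory: it converges to a node of
  `N₀` away from `N₁`, or its distance to `N₁` tends to `0`.
* `exists_stretching_le_near` — compactness: sub-stretching on the compact `N₁` gives `θ₁ < 1` and `δ > 0`
  with `⟪DU(y)w,w⟫ ≤ θ₁|w|²` whenever `infDist(y, N₁) < δ`.
* `curl_eq_zero_of_countable_union_substretching`, **`eq_zero_of_countable_union_substretching`** — the
  theorem; `eq_zero_of_stagnation_stretching_lt_one'` (g5) and `eq_zero_of_countable_nodalSet'` (g6)
  re-derived as the cases `N₀ = ∅`, `N₁ = ∅`.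

WHAT THIS IS NOT: not NS, not E, not rung C1 — classical (`C²`) profiles with the far field (3.8);
continua of stagnation points carrying stretching `≥ 1` somewhere, and the weak class, are untouched.

## References

* P. Constantin, M. Ignatova, V. Vicol, arXiv:2602.17570 (2026), §3.5 Thms 3.8–3.10, §4 (stagnation
  rings of axisymmetric profiles). [ConstantinIgnatovaVicol2026Putative]
-/

noncomputable section

-- flat `Theorems/<Route><Decl>…` files of one crux share the namespace of the crux (tree convention)
set_option linter.dupNamespace false

open Set Filter Topology Metric Function InnerProductSpace
open scoped RealInnerProductSpace NNReal

namespace Summit.NavierStokesRegularity.NavierStokesRegularity.Theorems.PowerGaugeEulerLiouville.NodalFiniteness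

open Literature.Analysis Literature.Analysis.FluidPDE Literature.Analysis.ODE

variable {γ C : ℝ} {c : EuclideanSpace ℝ (Fin 3)}
  {U : EuclideanSpace ℝ (Fin 3) → EuclideanSpace ℝ (Fin 3)} {P : EuclideanSpace ℝ (Fin 3) → ℝ}

/-! ### The inner product as a certificate -/

/-- The inner product of `ℝ³` as a continuous bilinear form `E →L E →L ℝ` (sum of rank-one forms over
an orthonormal basis). [folklore] -/
theorem exists_innerForm :
    ∃ B : EuclideanSpace ℝ (Fin 3) →L[ℝ] EuclideanSpace ℝ (Fin 3) →L[ℝ] ℝ, ∀ v w, B v w = ⟪v, w⟫ := by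
  set b := stdOrthonormalBasis ℝ (EuclideanSpace ℝ (Fin 3)) with hb
  refine ⟨∑ i, (innerSL ℝ (b i)).smulRight (innerSL ℝ (b i)), fun v w => ?_⟩
  simp only [FunLike.coe_sum, Finset.sum_apply, ContinuousLinearMap.smulRight_apply,
    FunLike.coe_smul, Pi.smul_apply, innerSL_apply_apply, smul_eq_mul]
  rw [← b.sum_inner_mul_inner v w]
  exact Finset.sum_congr rfl fun i _ => by rw [real_inner_comm (b i) v]

/-! ### KILL along a trajectory that eventually stays in a sub-stretching region -/

/-- **KILL without a limit node.** Let `(U, P)` be a `C²` self-similar Euler profile with `‖curl U‖ ≤ m`,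
`‖DU‖ ≤ K`, and `Y` a backward trajectory (`Y' = −V(Y)`) along which, from some time on,
`⟪DU(Y(t)) w, w⟫ ≤ θ₁‖w‖²` for all `w`, with `θ₁ < 1`.  Then `curl U (Y 0) = 0`: the weighted vorticity
`u = e^{−(1+γ)t}Ω(Y)` solves `u' = −DV(Y)u` with `d/dt ‖u‖² = −2γ‖u‖² − 2⟪DU u, u⟫ ≥ −2(γ+θ₁)‖u‖²`,
so it cannot decay at the rate `1 + γ > γ + θ₁` unless it vanishes.
[cite: ConstantinIgnatovaVicol2026Putative, §3.4.1 eq. (3.22) and proof of Thm 3.10] -/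
theorem curl_comp_eq_zero_of_eventually_stretching_le (h : IsSelfSimilarEulerProfile γ c U P)
    {m : ℝ} (hm : ∀ y, ‖curl U y‖ ≤ m) {K : ℝ} (hK : ∀ y, ‖fderiv ℝ U y‖ ≤ K)
    {Y : ℝ → EuclideanSpace ℝ (Fin 3)}
    (hY : ∀ t, HasDerivAt Y ((-1 : ℝ) • selfSimilarTransport γ c U (Y t)) t)
    {θ₁ : ℝ} (hθ₁ : θ₁ < 1)
    (hstretch : ∀ᶠ t in atTop, ∀ w, ⟪fderiv ℝ U (Y t) w, w⟫ ≤ θ₁ * ‖w‖ ^ 2) :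
    curl U (Y 0) = 0 := by
  obtain ⟨B, hB⟩ := exists_innerForm
  set V := selfSimilarTransport γ c U with hVdef
  set A : ℝ → EuclideanSpace ℝ (Fin 3) →L[ℝ] EuclideanSpace ℝ (Fin 3) :=
    fun t => (-1 : ℝ) • fderiv ℝ V (Y t) with hA
  set u : ℝ → EuclideanSpace ℝ (Fin 3) :=
    fun s => Real.exp ((-1 : ℝ) * (1 + γ) * s) • curl U (Y s) with hu
  have hu' : ∀ t, HasDerivAt u (A t (u t)) t := fun t => hasDerivAt_weightedCurl_comp h (hY t)
  have hdecay : ∀ t, ‖u t‖ ≤ m * Real.exp (-(1 + γ) * t) := by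
    intro t
    simp only [hu, norm_smul, Real.norm_eq_abs, abs_of_pos (Real.exp_pos _)]
    rw [mul_comm]
    have : Real.exp ((-1 : ℝ) * (1 + γ) * t) = Real.exp (-(1 + γ) * t) := by ring_nf
    rw [this]
    exact mul_le_mul_of_nonneg_right (hm _) (Real.exp_pos _).le
  obtain ⟨t₁, ht₁⟩ := (hstretch.and (eventually_ge_atTop 0)).exists_forall_of_atTop
  set t₀ : ℝ := max t₁ 0 with ht₀
  have ht₀0 : 0 ≤ t₀ := le_max_right _ _
  have hUd := h.differentiable_velocity
  -- the certificate along the trajectory: `B(Av,v) + B(v,Av) = -2γ|v|² - 2⟪DU v, v⟫ ≥ -2(γ+θ₁)|v|²`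
  have hAcert : ∀ t, t₀ ≤ t → ∀ v, 2 * (-(γ + θ₁)) * B v v ≤ B (A t v) v + B v (A t v) := by
    intro t ht v
    have hs := (ht₁ t ((le_max_left _ _).trans ht)).1 v
    have hAv : A t v = -(γ • v + fderiv ℝ U (Y t) v) := by
      simp only [hA, hVdef, (hasFDerivAt_selfSimilarTransport hUd (Y t)).fderiv, neg_smul, one_smul,
        add_apply, FunLike.coe_smul, Pi.smul_apply, ContinuousLinearMap.id_apply]
    rw [hB, hB, hB, hAv, inner_neg_left, inner_neg_right, inner_add_left, inner_add_right,
      real_inner_smul_left, real_inner_smul_right, real_inner_self_eq_norm_sq,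
      real_inner_comm (fderiv ℝ U (Y t) v) v]
    nlinarith [hs]
  have hgap : 0 < (1 + γ) + -(γ + θ₁) := by linarith
  have hBcoer : ∀ v : EuclideanSpace ℝ (Fin 3), 1 * ‖v‖ ^ 2 ≤ B v v := fun v => by
    rw [hB, real_inner_self_eq_norm_sq, one_mul]
  have hut₀ : u t₀ = 0 :=
    eq_zero_of_norm_le_exp_of_lower_certificate B one_pos hBcoer (fun t _ => hu' t) hAcert
      (fun t _ => hdecay t) hgap
  -- back to `t = 0` by uniqueness
  have hKV : ∀ t, LipschitzOnWith (Real.toNNReal (|γ| + K))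
      (fun x : EuclideanSpace ℝ (Fin 3) => A t x) univ := by
    intro t
    refine ((A t).lipschitz.weaken ?_).lipschitzOnWith
    rw [← NNReal.coe_le_coe, coe_nnnorm,
      Real.coe_toNNReal _ (add_nonneg (abs_nonneg γ) ((norm_nonneg _).trans (hK 0)))]
    calc ‖A t‖ = ‖fderiv ℝ V (Y t)‖ := by
          show ‖(-1 : ℝ) • fderiv ℝ V (Y t)‖ = _
          rw [norm_smul, norm_neg, norm_one, one_mul]
      _ ≤ |γ| + K := norm_fderiv_transport_le h hK (Y t)
  have hcont : ContinuousOn u (Icc 0 t₀) := fun t _ => (hu' t).continuousAt.continuousWithinAt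
  have hEq : EqOn u (fun _ => (0 : EuclideanSpace ℝ (Fin 3))) (Icc 0 t₀) :=
    ODE_solution_unique_of_mem_Icc_left (v := fun t x => A t x) (s := fun _ => univ)
      (fun t _ => hKV t) hcont (fun t _ => (hu' t).hasDerivWithinAt) (fun _ _ => mem_univ _)
      continuousOn_const
      (fun t _ => by
        have h0 : HasDerivWithinAt (fun _ : ℝ => (0 : EuclideanSpace ℝ (Fin 3))) 0 (Iic t) t :=
          hasDerivWithinAt_const _ _ _
        simpa using h0)
      (fun _ _ => mem_univ _) (by simpa using hut₀)
  have hu0 : u 0 = 0 := hEq ⟨le_rfl, ht₀0⟩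
  simpa [hu] using hu0

/-! ### Convergence to a cluster point with zero-free spheres -/

/-- **A bounded curve along which `V → 0` converges to its cluster point `z` if arbitrarily small spheres
about `z` carry no zero of `V`** (intermediate value theorem, as in the countable case). [folklore] -/
theorem tendsto_of_transport_comp_tendsto_zero_of_sphereFree
    {V : EuclideanSpace ℝ (Fin 3) → EuclideanSpace ℝ (Fin 3)} (hVc : Continuous V)
    {Y : ℝ → EuclideanSpace ℝ (Fin 3)} (hYc : Continuous Y) {B : ℝ} (hB : ∀ t, 0 ≤ t → ‖Y t‖ ≤ B)
    (hV0 : Tendsto (fun t => V (Y t)) atTop (𝓝 0)) {z : EuclideanSpace ℝ (Fin 3)}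
    (hcl : MapClusterPt z atTop Y)
    (hfree : ∀ ε, 0 < ε → ∃ r ∈ Ioo 0 ε, ∀ y, V y = 0 → dist y z ≠ r) :
    Tendsto Y atTop (𝓝 z) := by
  rw [Metric.tendsto_atTop]
  intro ε hε
  obtain ⟨r, ⟨hr0, hrε⟩, hrS⟩ := hfree ε hε
  set K : Set (EuclideanSpace ℝ (Fin 3)) := closedBall 0 B ∩ {y | dist y z = r} with hK
  have hKc : IsCompact K :=
    (isCompact_closedBall 0 B).inter_right (isClosed_eq (continuous_id.dist continuous_const)
      continuous_const)
  have hVpos : ∀ y ∈ K, 0 < ‖V y‖ := by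
    rintro y ⟨_, hy⟩
    rw [norm_pos_iff]
    intro hVy
    exact hrS y hVy hy
  obtain ⟨m₀, hm₀, hKle⟩ := hKc.exists_forall_le' hVc.norm.continuousOn hVpos
  have hev : ∀ᶠ t in atTop, ‖V (Y t)‖ < m₀ :=
    (tendsto_zero_iff_norm_tendsto_zero.1 hV0).eventually (Iio_mem_nhds hm₀)
  obtain ⟨T, hT⟩ := (hev.and (eventually_ge_atTop 0)).exists_forall_of_atTop
  have hfreq : ∃ᶠ t in atTop, Y t ∈ ball z r := hcl.frequently (ball_mem_nhds z hr0)
  obtain ⟨t₁, ht₁, ht₁T⟩ := (hfreq.and_eventually (eventually_ge_atTop T)).exists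
  refine ⟨t₁, fun t ht => ?_⟩
  have htT : T ≤ t := ht₁T.trans ht
  by_contra hge
  push Not at hge
  have hge' : r ≤ dist (Y t) z := hrε.le.trans hge
  have hcont : ContinuousOn (fun s => dist (Y s) z) (Icc t₁ t) :=
    (hYc.dist continuous_const).continuousOn
  have hmem : r ∈ Icc (dist (Y t₁) z) (dist (Y t) z) := ⟨(mem_ball.1 ht₁).le, hge'⟩
  obtain ⟨s, hs, hsr⟩ := intermediate_value_Icc ht hcont hmem
  have hsT : T ≤ s := ht₁T.trans hs.1
  have hs0 : 0 ≤ s := (hT s hsT).2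
  have hYsK : Y s ∈ K := ⟨mem_closedBall_zero_iff.2 (hB s hs0), by simpa using hsr⟩
  have h1 := hKle (Y s) hYsK
  have h2 := (hT s hsT).1
  linarith

/-! ### Dichotomy: convergence to an isolated-type node, or approach of the continuum part -/

/-- **Dichotomy for a bounded curve with `V(Y) → 0` when the zero set of `V` lies in `N₀ ∪ N₁`, `N₀`
countable, `N₁` closed:** either the distance from `Y(t)` to `N₁` tends to `0`, or `Y` converges to a
zero `z` of `V` with `z ∉ N₁`.  (If the distance does not tend to zero, a cluster point `z` at positive
distance `ε₀` from `N₁` exists by compactness; spheres about `z` of radius `< ε₀` avoiding the countably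
many distances to `N₀` are zero-free, so `Y → z`.) [folklore] -/
theorem tendsto_or_infDist_tendsto_zero
    {V : EuclideanSpace ℝ (Fin 3) → EuclideanSpace ℝ (Fin 3)} (hVc : Continuous V)
    {N₀ N₁ : Set (EuclideanSpace ℝ (Fin 3))} (hN₀ : N₀.Countable)
    (hzero : ∀ y, V y = 0 → y ∈ N₀ ∪ N₁)
    {Y : ℝ → EuclideanSpace ℝ (Fin 3)} (hYc : Continuous Y) {B : ℝ} (hB : ∀ t, 0 ≤ t → ‖Y t‖ ≤ B)
    (hV0 : Tendsto (fun t => V (Y t)) atTop (𝓝 0)) :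
    Tendsto (fun t => infDist (Y t) N₁) atTop (𝓝 0) ∨
      ∃ z, V z = 0 ∧ z ∉ N₁ ∧ Tendsto Y atTop (𝓝 z) := by
  by_cases hlim : Tendsto (fun t => infDist (Y t) N₁) atTop (𝓝 0)
  · exact Or.inl hlim
  right
  -- a positive `ε₀` with `infDist (Y t) N₁ ≥ ε₀` frequently
  have hfreq : ∃ ε₀ : ℝ, 0 < ε₀ ∧ ∃ᶠ t in atTop, ε₀ ≤ infDist (Y t) N₁ := by
    by_contra hcon
    push Not at hcon
    apply hlim
    rw [Metric.tendsto_atTop]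
    intro ε hε
    have hev := hcon ε hε
    obtain ⟨T, hT⟩ := hev.exists_forall_of_atTop
    exact ⟨T, fun t ht => by
      rw [Real.dist_eq, sub_zero, abs_of_nonneg infDist_nonneg]; exact hT t ht⟩
  obtain ⟨ε₀, hε₀, hfr⟩ := hfreq
  -- a cluster point along those times
  set F : Filter ℝ := atTop ⊓ 𝓟 {t | ε₀ ≤ infDist (Y t) N₁} with hF
  haveI : F.NeBot := by
    rw [hF, inf_principal_neBot_iff]
    intro U hU
    exact (hfr.and_eventually hU).exists.imp fun t ht => ⟨ht.2, ht.1⟩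
  have hFle : F ≤ atTop := inf_le_left
  have hK := isCompact_closedBall (0 : EuclideanSpace ℝ (Fin 3)) B
  have hle : map Y F ≤ 𝓟 (closedBall (0 : EuclideanSpace ℝ (Fin 3)) B) := by
    rw [le_principal_iff, mem_map]
    exact hFle (by filter_upwards [eventually_ge_atTop (0 : ℝ)] with t ht
                  using mem_closedBall_zero_iff.2 (hB t ht))
  obtain ⟨z, _, hzF⟩ := hK.exists_clusterPt hle
  -- `z` is at distance `≥ ε₀` from `N₁`
  have hzfar : ε₀ ≤ infDist z N₁ := by
    have hS : IsClosed {y : EuclideanSpace ℝ (Fin 3) | ε₀ ≤ infDist y N₁} :=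
      isClosed_le continuous_const (continuous_infDist_pt N₁)
    have hle' : map Y F ≤ 𝓟 {y | ε₀ ≤ infDist y N₁} := by
      rw [le_principal_iff, mem_map, hF]
      exact mem_inf_of_right (mem_principal_self _)
    have hzcl : z ∈ closure {y : EuclideanSpace ℝ (Fin 3) | ε₀ ≤ infDist y N₁} :=
      mem_closure_iff_clusterPt.2 (hzF.mono hle')
    rw [hS.closure_eq] at hzcl
    exact hzcl
  -- `V z = 0`
  have hzMap : MapClusterPt z F Y := hzF
  have hVz : V z = 0 := by
    by_contra hne
    have hpos : 0 < ‖V z‖ := norm_pos_iff.2 hne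
    have hW : {y : EuclideanSpace ℝ (Fin 3) | ‖V z‖ / 2 < ‖V y‖} ∈ 𝓝 z :=
      (isOpen_lt continuous_const hVc.norm).mem_nhds (by simp only [mem_setOf_eq]; linarith)
    have hfrW := hzMap.frequently hW
    have hev : ∀ᶠ t in F, ‖V (Y t)‖ < ‖V z‖ / 2 :=
      hFle ((tendsto_zero_iff_norm_tendsto_zero.1 hV0).eventually (Iio_mem_nhds (by positivity)))
    obtain ⟨t, ht1, ht2⟩ := (hfrW.and_eventually hev).exists
    exact absurd ht1 (not_lt.2 ht2.le)
  have hzN₁ : z ∉ N₁ := by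
    intro hz
    have := infDist_zero_of_mem (x := z) hz
    linarith
  have hzN₀ : z ∈ N₀ := (hzero z hVz).resolve_right hzN₁
  have hcl : MapClusterPt z atTop Y := hzF.mono (map_mono hFle)
  -- zero-free spheres about `z`
  have hfree : ∀ ε, 0 < ε → ∃ r ∈ Ioo 0 ε, ∀ y, V y = 0 → dist y z ≠ r := by
    intro ε hε
    have hD : ((fun y => dist y z) '' N₀).Countable := hN₀.image _
    obtain ⟨r, hrD, hr⟩ := (hD.dense_compl ℝ).exists_mem_open isOpen_Ioo
      (nonempty_Ioo.2 (lt_min hε hε₀))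
    refine ⟨r, ⟨hr.1, hr.2.trans_le (min_le_left _ _)⟩, fun y hy hyr => ?_⟩
    rcases hzero y hy with hy0 | hy1
    · exact hrD ⟨y, hy0, hyr⟩
    · have h1 : ε₀ ≤ dist y z := by
        rw [dist_comm]; exact hzfar.trans (infDist_le_dist_of_mem hy1)
      have h2 : r < ε₀ := hr.2.trans_le (min_le_right _ _)
      linarith
  exact ⟨z, hVz, hzN₁, tendsto_of_transport_comp_tendsto_zero_of_sphereFree hVc hYc hB hV0 hcl hfree⟩

/-! ### Uniform sub-stretching near a compact sub-stretching set -/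

/-- **Compactness.** If `U ∈ C²` and `⟪DU(z)w,w⟫ < |w|²` for every `z` in a nonempty compact set `N₁`
and every `w ≠ 0`, then there are `θ₁ < 1` and `δ > 0` with `⟪DU(y)w,w⟫ ≤ θ₁|w|²` for all `w` whenever
`infDist(y, N₁) < δ` (continuity of `y ↦ sup_{|w|=1}⟪DU(y)w,w⟫`, Mathlib `IsCompact.continuous_sSup`,
and `IsCompact.exists_cthickening_subset_open`). [folklore] -/
theorem exists_stretching_le_near (hU : ContDiff ℝ 2 U) {N₁ : Set (EuclideanSpace ℝ (Fin 3))}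
    (hN₁c : IsCompact N₁) (hne : N₁.Nonempty)
    (hsub : ∀ z ∈ N₁, ∀ w : EuclideanSpace ℝ (Fin 3), w ≠ 0 → ⟪fderiv ℝ U z w, w⟫ < ‖w‖ ^ 2) :
    ∃ θ₁ : ℝ, θ₁ < 1 ∧ ∃ δ : ℝ, 0 < δ ∧ ∀ y, infDist y N₁ < δ →
      ∀ w : EuclideanSpace ℝ (Fin 3), ⟪fderiv ℝ U y w, w⟫ ≤ θ₁ * ‖w‖ ^ 2 := by
  have hDUc : Continuous (fderiv ℝ U) := hU.continuous_fderiv (by norm_num)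
  set f : EuclideanSpace ℝ (Fin 3) → EuclideanSpace ℝ (Fin 3) → ℝ :=
    fun y w => ⟪fderiv ℝ U y w, w⟫ with hf
  have hfc : Continuous ↿f := by
    have h1 : Continuous fun p : EuclideanSpace ℝ (Fin 3) × EuclideanSpace ℝ (Fin 3) =>
        fderiv ℝ U p.1 p.2 := (hDUc.comp continuous_fst).clm_apply continuous_snd
    exact h1.inner continuous_snd
  set Sph : Set (EuclideanSpace ℝ (Fin 3)) := sphere 0 1 with hSph
  have hSc : IsCompact Sph := isCompact_sphere 0 1
  have hSne : Sph.Nonempty := ⟨EuclideanSpace.single 0 1, by simp [hSph, PiLp.norm_single]⟩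
  set g : EuclideanSpace ℝ (Fin 3) → ℝ := fun y => sSup (f y '' Sph) with hg
  have hgc : Continuous g := hSc.continuous_sSup hfc
  -- `g z < 1` on `N₁`
  have hg1 : ∀ z ∈ N₁, g z < 1 := by
    intro z hz
    rw [hg]
    refine (hSc.sSup_lt_iff_of_continuous hSne (hfc.uncurry_left z).continuousOn 1).2 ?_
    intro w hw
    have hw1 : ‖w‖ = 1 := by simpa [hSph] using hw
    have hw0 : w ≠ 0 := by rw [← norm_ne_zero_iff, hw1]; exact one_ne_zero
    have := hsub z hz w hw0
    rw [hw1, one_pow] at this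
    exact this
  -- the maximum `m₁ < 1` of `g` on `N₁`, `θ₁ = (1 + m₁)/2`
  set m₁ : ℝ := sSup (g '' N₁) with hm₁
  have hm₁lt : m₁ < 1 := (hN₁c.sSup_lt_iff_of_continuous hne hgc.continuousOn 1).2 hg1
  set θ₁ : ℝ := (1 + m₁) / 2 with hθ₁
  have hθ₁lt : θ₁ < 1 := by rw [hθ₁]; linarith
  have hgN₁ : ∀ z ∈ N₁, g z < θ₁ := fun z hz =>
    (le_csSup (hN₁c.bddAbove_image hgc.continuousOn) (mem_image_of_mem g hz)).trans_lt
      (by rw [hθ₁]; linarith)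
  set O : Set (EuclideanSpace ℝ (Fin 3)) := g ⁻¹' Iio θ₁ with hO
  have hOo : IsOpen O := isOpen_Iio.preimage hgc
  have hNO : N₁ ⊆ O := fun z hz => hgN₁ z hz
  obtain ⟨δ, hδ, hδO⟩ := hN₁c.exists_cthickening_subset_open hOo hNO
  refine ⟨θ₁, hθ₁lt, δ, hδ, fun y hy w => ?_⟩
  have hyO : y ∈ O := hδO (thickening_subset_cthickening δ N₁ ((mem_thickening_iff_infDist_lt hne).2 hy))
  have hgy : g y < θ₁ := hyO
  by_cases hw : w = 0
  · simp [hw]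
  have hn : ‖w‖ ≠ 0 := norm_ne_zero_iff.2 hw
  set e : EuclideanSpace ℝ (Fin 3) := ‖w‖⁻¹ • w with he
  have he1 : ‖e‖ = 1 := by rw [he, norm_smul, norm_inv, norm_norm, inv_mul_cancel₀ hn]
  have heS : e ∈ Sph := by simpa [hSph] using he1
  have hfe : f y e ≤ g y := le_csSup (hSc.bddAbove_image (hfc.uncurry_left y).continuousOn)
    (mem_image_of_mem _ heS)
  have hwe : w = ‖w‖ • e := by rw [he, smul_smul, mul_inv_cancel₀ hn, one_smul]
  have h2 : ⟪fderiv ℝ U y w, w⟫ = ‖w‖ ^ 2 * f y e := by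
    rw [hwe, map_smul, inner_smul_left, inner_smul_right, conj_trivial, norm_smul, norm_norm,
      he1, mul_one, hf]
    ring
  rw [h2]
  nlinarith [sq_nonneg ‖w‖, hfe, hgy]

end Summit.NavierStokesRegularity.NavierStokesRegularity.Theorems.PowerGaugeEulerLiouville.NodalFiniteness
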